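import Literature.NumberTheory.QuadraticFields.ThreeTorsionMeanProgressionCount
import HarnessLib

/-!
# Taniguchi–Thorne, Lemma 21: fundamental discriminants in a class `a (mod m)`, `16 ∣ m`

When `16 ∣ m`, the class `a (mod m)` fixes `D (mod 16)`, so at most ONE 2-adic type of
fundamental discriminant occurs (`fundDiscr_cond_iff`, `ThreeTorsionMeanProgressionCount.lean`):
type I (`D ≡ 1 (mod 4)` squarefree) iff `a ≡ 1 (mod 4)`; type II (`D = 4d`, `d ≡ 3 (mod 4)`
squarefree) iff `a ≡ 12 (mod 16)`, and then `d ≡ a/4 (mod m/4)`; type III (`D = 8k`, `k` odd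
squarefree) iff `a ≡ 8 (mod 16)`, and then `k ≡ a/8 (mod m/8)`; no fundamental discriminant
otherwise. This file PROVES these eight set identities (negative and positive discriminants),
the combinatorial half of Taniguchi–Thorne 2013, Lemma 21 (`ThreeTorsionMeanLemma21.lean`).

## References
* T. Taniguchi, F. Thorne, *Secondary terms in counting functions for cubic fields*, Duke Math. J.
  162 (2013), Lemma 21 [TaniguchiThorne2013].
-/

noncomputable section

open Finset

namespace Literature.NumberTheory.QuadraticFields

/-- Scaling a congruence: for `t ≠ 0`, `t x ≡ t y (mod t n) ↔ x ≡ y (mod n)`. [folklore] -/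
theorem mul_modEq_mul_iff {t : ℤ} (ht : t ≠ 0) {x y n : ℤ} :
    t * x ≡ t * y [ZMOD t * n] ↔ x ≡ y [ZMOD n] := by
  rw [Int.modEq_iff_dvd, Int.modEq_iff_dvd, ← mul_sub, mul_dvd_mul_iff_left ht]

/-! ### Negative discriminants -/

/-- Type I: for `4 ∣ m` and `a ≡ 1 (mod 4)`, `{D ∈ negFundDiscrs X : D ≡ a (mod m)}` is the set of
squarefree `D ∈ [1 - X, 0)` with `D ≡ a (mod m)`. [cite: TaniguchiThorne2013, Lemma 21] -/
theorem negFundDiscrs_filter_modEq_eq_of_mod_four {m : ℕ} (hm4 : 4 ∣ m) {a : ℤ} (ha : a % 4 = 1)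
    (X : ℕ) :
    (negFundDiscrs X).filter (fun D => D ≡ a [ZMOD m]) =
      (Ico (1 - (X : ℤ)) 0).filter (fun x => x ≡ a [ZMOD m] ∧ Squarefree x) := by
  have h4 : (4 : ℤ) ∣ (m : ℤ) := by exact_mod_cast hm4
  ext D
  simp only [Finset.mem_filter, Finset.mem_Ico, mem_negFundDiscrs, fundDiscr_cond_iff]
  constructor
  · rintro ⟨⟨⟨hlo, hhi⟩, hcases⟩, hmod⟩
    have hD4 : D % 4 = a % 4 := hmod.of_dvd h4
    rcases hcases with ⟨hD1, hsq, -⟩ | ⟨d, rfl, hd3, hsq⟩ | ⟨k, rfl, hk, hsq⟩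
    · exact ⟨⟨by omega, hhi⟩, hmod, hsq⟩
    · exfalso; omega
    · exfalso; omega
  · rintro ⟨⟨hlo, hhi⟩, hmod, hsq⟩
    have hD4 : D % 4 = a % 4 := hmod.of_dvd h4
    exact ⟨⟨⟨by omega, hhi⟩, Or.inl ⟨by omega, hsq, by omega⟩⟩, hmod⟩

/-- Type II: for `16 ∣ m` and `a ≡ 12 (mod 16)`, `{D ∈ negFundDiscrs X : D ≡ a (mod m)}` is
`4 ·` the set of squarefree `d ∈ [-(X-1)/4, 0)` with `d ≡ a/4 (mod m/4)`. [cite: TaniguchiThorne2013, Lemma 21] -/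
theorem negFundDiscrs_filter_modEq_eq_of_mod_sixteen_twelve {m : ℕ} (hm16 : 16 ∣ m) {a : ℤ}
    (ha : a % 16 = 12) (X : ℕ) :
    (negFundDiscrs X).filter (fun D => D ≡ a [ZMOD m]) =
      ((Ico (-(((X : ℤ) - 1) / 4)) 0).filter
          (fun x => x ≡ a / 4 [ZMOD ((m / 4 : ℕ) : ℤ)] ∧ Squarefree x)).image (fun d => 4 * d) := by
  have h16 : (16 : ℤ) ∣ (m : ℤ) := by exact_mod_cast hm16
  have hm4 : (m : ℤ) = 4 * ((m / 4 : ℕ) : ℤ) := by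
    have : m = 4 * (m / 4) := (Nat.mul_div_cancel' ((dvd_mul_right 4 4).trans hm16)).symm
    exact_mod_cast this
  have h4q : (4 : ℤ) ∣ ((m / 4 : ℕ) : ℤ) := by
    have : 4 ∣ m / 4 := Nat.dvd_div_of_mul_dvd (by simpa using hm16)
    exact_mod_cast this
  have ha4 : a = 4 * (a / 4) := by omega
  ext D
  simp only [Finset.mem_filter, Finset.mem_image, Finset.mem_Ico, mem_negFundDiscrs,
    fundDiscr_cond_iff]
  constructor
  · rintro ⟨⟨⟨hlo, hhi⟩, hcases⟩, hmod⟩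
    have hD16 : D % 16 = a % 16 := hmod.of_dvd h16
    rcases hcases with ⟨hD1, hsq, -⟩ | ⟨d, rfl, hd3, hsq⟩ | ⟨k, rfl, hk, hsq⟩
    · exfalso; omega
    · refine ⟨d, ⟨⟨by omega, by omega⟩, ?_, hsq⟩, rfl⟩
      rw [ha4, hm4] at hmod
      exact (mul_modEq_mul_iff four_ne_zero).1 hmod
    · exfalso; omega
  · rintro ⟨d, ⟨⟨hlo, hhi⟩, hmod, hsq⟩, rfl⟩
    have hd4 : d % 4 = a / 4 % 4 := hmod.of_dvd h4q
    refine ⟨⟨⟨by omega, by omega⟩, Or.inr (Or.inl ⟨d, rfl, by omega, hsq⟩)⟩, ?_⟩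
    have h := (mul_modEq_mul_iff (four_ne_zero (α := ℤ))).2 hmod
    rwa [← ha4, ← hm4] at h

/-- Type III: for `16 ∣ m` and `a ≡ 8 (mod 16)`, `{D ∈ negFundDiscrs X : D ≡ a (mod m)}` is
`8 ·` the set of squarefree `k ∈ [-(X-1)/8, 0)` with `k ≡ a/8 (mod m/8)`. [cite: TaniguchiThorne2013, Lemma 21] -/
theorem negFundDiscrs_filter_modEq_eq_of_mod_sixteen_eight {m : ℕ} (hm16 : 16 ∣ m) {a : ℤ}
    (ha : a % 16 = 8) (X : ℕ) :
    (negFundDiscrs X).filter (fun D => D ≡ a [ZMOD m]) =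
      ((Ico (-(((X : ℤ) - 1) / 8)) 0).filter
          (fun x => x ≡ a / 8 [ZMOD ((m / 8 : ℕ) : ℤ)] ∧ Squarefree x)).image (fun k => 8 * k) := by
  have h16 : (16 : ℤ) ∣ (m : ℤ) := by exact_mod_cast hm16
  have hm8 : (m : ℤ) = 8 * ((m / 8 : ℕ) : ℤ) := by
    have : m = 8 * (m / 8) := (Nat.mul_div_cancel' ((dvd_mul_right 8 2).trans hm16)).symm
    exact_mod_cast this
  have h2q : (2 : ℤ) ∣ ((m / 8 : ℕ) : ℤ) := by
    have : 2 ∣ m / 8 := Nat.dvd_div_of_mul_dvd (by simpa using hm16)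
    exact_mod_cast this
  have ha8 : a = 8 * (a / 8) := by omega
  ext D
  simp only [Finset.mem_filter, Finset.mem_image, Finset.mem_Ico, mem_negFundDiscrs,
    fundDiscr_cond_iff]
  constructor
  · rintro ⟨⟨⟨hlo, hhi⟩, hcases⟩, hmod⟩
    have hD16 : D % 16 = a % 16 := hmod.of_dvd h16
    rcases hcases with ⟨hD1, hsq, -⟩ | ⟨d, rfl, hd3, hsq⟩ | ⟨k, rfl, hk, hsq⟩
    · exfalso; omega
    · exfalso; omega
    · refine ⟨k, ⟨⟨by omega, by omega⟩, ?_, hsq⟩, rfl⟩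
      rw [ha8, hm8] at hmod
      exact (mul_modEq_mul_iff (by norm_num)).1 hmod
  · rintro ⟨k, ⟨⟨hlo, hhi⟩, hmod, hsq⟩, rfl⟩
    have hk2 : k % 2 = a / 8 % 2 := hmod.of_dvd h2q
    refine ⟨⟨⟨by omega, by omega⟩, Or.inr (Or.inr ⟨k, rfl, by omega, hsq⟩)⟩, ?_⟩
    have h := (mul_modEq_mul_iff (by norm_num : (8 : ℤ) ≠ 0)).2 hmod
    rwa [← ha8, ← hm8] at h

/-- No fundamental discriminant: for `16 ∣ m` and `a ≢ 1 (mod 4)`, `a ≢ 8, 12 (mod 16)`, the set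
`{D ∈ negFundDiscrs X : D ≡ a (mod m)}` is empty. [cite: TaniguchiThorne2013, Lemma 21] -/
theorem negFundDiscrs_filter_modEq_eq_empty {m : ℕ} (hm16 : 16 ∣ m) {a : ℤ} (ha4 : a % 4 ≠ 1)
    (ha12 : a % 16 ≠ 12) (ha8 : a % 16 ≠ 8) (X : ℕ) :
    (negFundDiscrs X).filter (fun D => D ≡ a [ZMOD m]) = ∅ := by
  have h16 : (16 : ℤ) ∣ (m : ℤ) := by exact_mod_cast hm16
  refine Finset.filter_eq_empty_iff.2 fun D hD hmod => ?_
  have hD16 : D % 16 = a % 16 := hmod.of_dvd h16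
  rw [mem_negFundDiscrs, fundDiscr_cond_iff] at hD
  rcases hD.2 with ⟨hD1, -, -⟩ | ⟨d, rfl, hd3, -⟩ | ⟨k, rfl, hk, -⟩
  · omega
  · omega
  · omega

/-! ### Positive discriminants -/

/-- Type I, positive: for `4 ∣ m`, `a ≡ 1 (mod 4)`, `{D ∈ posFundDiscrs X : D ≡ a (mod m)}` is the
set of squarefree `D ∈ [2, X)` with `D ≡ a (mod m)`. [cite: TaniguchiThorne2013, Lemma 21] -/
theorem posFundDiscrs_filter_modEq_eq_of_mod_four {m : ℕ} (hm4 : 4 ∣ m) {a : ℤ} (ha : a % 4 = 1)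
    (X : ℕ) :
    (posFundDiscrs X).filter (fun D => D ≡ a [ZMOD m]) =
      (Ico (2 : ℤ) X).filter (fun x => x ≡ a [ZMOD m] ∧ Squarefree x) := by
  have h4 : (4 : ℤ) ∣ (m : ℤ) := by exact_mod_cast hm4
  ext D
  simp only [Finset.mem_filter, Finset.mem_Ico, mem_posFundDiscrs, fundDiscr_cond_iff]
  constructor
  · rintro ⟨⟨⟨hlo, hhi⟩, hcases⟩, hmod⟩
    have hD4 : D % 4 = a % 4 := hmod.of_dvd h4
    rcases hcases with ⟨hD1, hsq, hne⟩ | ⟨d, rfl, hd3, hsq⟩ | ⟨k, rfl, hk, hsq⟩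
    · exact ⟨⟨by omega, hhi⟩, hmod, hsq⟩
    · exfalso; omega
    · exfalso; omega
  · rintro ⟨⟨hlo, hhi⟩, hmod, hsq⟩
    have hD4 : D % 4 = a % 4 := hmod.of_dvd h4
    exact ⟨⟨⟨by omega, hhi⟩, Or.inl ⟨by omega, hsq, by omega⟩⟩, hmod⟩

/-- Type II, positive: for `16 ∣ m`, `a ≡ 12 (mod 16)`, `{D ∈ posFundDiscrs X : D ≡ a (mod m)}`
is `4 ·` the set of squarefree `d ∈ [1, (X-1)/4 + 1)` with `d ≡ a/4 (mod m/4)`. [cite: TaniguchiThorne2013, Lemma 21] -/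
theorem posFundDiscrs_filter_modEq_eq_of_mod_sixteen_twelve {m : ℕ} (hm16 : 16 ∣ m) {a : ℤ}
    (ha : a % 16 = 12) (X : ℕ) :
    (posFundDiscrs X).filter (fun D => D ≡ a [ZMOD m]) =
      ((Ico (1 : ℤ) (((X : ℤ) - 1) / 4 + 1)).filter
          (fun x => x ≡ a / 4 [ZMOD ((m / 4 : ℕ) : ℤ)] ∧ Squarefree x)).image (fun d => 4 * d) := by
  have h16 : (16 : ℤ) ∣ (m : ℤ) := by exact_mod_cast hm16
  have hm4 : (m : ℤ) = 4 * ((m / 4 : ℕ) : ℤ) := by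
    have : m = 4 * (m / 4) := (Nat.mul_div_cancel' ((dvd_mul_right 4 4).trans hm16)).symm
    exact_mod_cast this
  have h4q : (4 : ℤ) ∣ ((m / 4 : ℕ) : ℤ) := by
    have : 4 ∣ m / 4 := Nat.dvd_div_of_mul_dvd (by simpa using hm16)
    exact_mod_cast this
  have ha4 : a = 4 * (a / 4) := by omega
  ext D
  simp only [Finset.mem_filter, Finset.mem_image, Finset.mem_Ico, mem_posFundDiscrs,
    fundDiscr_cond_iff]
  constructor
  · rintro ⟨⟨⟨hlo, hhi⟩, hcases⟩, hmod⟩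
    have hD16 : D % 16 = a % 16 := hmod.of_dvd h16
    rcases hcases with ⟨hD1, hsq, -⟩ | ⟨d, rfl, hd3, hsq⟩ | ⟨k, rfl, hk, hsq⟩
    · exfalso; omega
    · refine ⟨d, ⟨⟨by omega, by omega⟩, ?_, hsq⟩, rfl⟩
      rw [ha4, hm4] at hmod
      exact (mul_modEq_mul_iff four_ne_zero).1 hmod
    · exfalso; omega
  · rintro ⟨d, ⟨⟨hlo, hhi⟩, hmod, hsq⟩, rfl⟩
    have hd4 : d % 4 = a / 4 % 4 := hmod.of_dvd h4q
    refine ⟨⟨⟨by omega, by omega⟩, Or.inr (Or.inl ⟨d, rfl, by omega, hsq⟩)⟩, ?_⟩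
    have h := (mul_modEq_mul_iff (four_ne_zero (α := ℤ))).2 hmod
    rwa [← ha4, ← hm4] at h

/-- Type III, positive: for `16 ∣ m`, `a ≡ 8 (mod 16)`, `{D ∈ posFundDiscrs X : D ≡ a (mod m)}`
is `8 ·` the set of squarefree `k ∈ [1, (X-1)/8 + 1)` with `k ≡ a/8 (mod m/8)`. [cite: TaniguchiThorne2013, Lemma 21] -/
theorem posFundDiscrs_filter_modEq_eq_of_mod_sixteen_eight {m : ℕ} (hm16 : 16 ∣ m) {a : ℤ}
    (ha : a % 16 = 8) (X : ℕ) :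
    (posFundDiscrs X).filter (fun D => D ≡ a [ZMOD m]) =
      ((Ico (1 : ℤ) (((X : ℤ) - 1) / 8 + 1)).filter
          (fun x => x ≡ a / 8 [ZMOD ((m / 8 : ℕ) : ℤ)] ∧ Squarefree x)).image (fun k => 8 * k) := by
  have h16 : (16 : ℤ) ∣ (m : ℤ) := by exact_mod_cast hm16
  have hm8 : (m : ℤ) = 8 * ((m / 8 : ℕ) : ℤ) := by
    have : m = 8 * (m / 8) := (Nat.mul_div_cancel' ((dvd_mul_right 8 2).trans hm16)).symm
    exact_mod_cast this
  have h2q : (2 : ℤ) ∣ ((m / 8 : ℕ) : ℤ) := by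
    have : 2 ∣ m / 8 := Nat.dvd_div_of_mul_dvd (by simpa using hm16)
    exact_mod_cast this
  have ha8 : a = 8 * (a / 8) := by omega
  ext D
  simp only [Finset.mem_filter, Finset.mem_image, Finset.mem_Ico, mem_posFundDiscrs,
    fundDiscr_cond_iff]
  constructor
  · rintro ⟨⟨⟨hlo, hhi⟩, hcases⟩, hmod⟩
    have hD16 : D % 16 = a % 16 := hmod.of_dvd h16
    rcases hcases with ⟨hD1, hsq, -⟩ | ⟨d, rfl, hd3, hsq⟩ | ⟨k, rfl, hk, hsq⟩
    · exfalso; omega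
    · exfalso; omega
    · refine ⟨k, ⟨⟨by omega, by omega⟩, ?_, hsq⟩, rfl⟩
      rw [ha8, hm8] at hmod
      exact (mul_modEq_mul_iff (by norm_num)).1 hmod
  · rintro ⟨k, ⟨⟨hlo, hhi⟩, hmod, hsq⟩, rfl⟩
    have hk2 : k % 2 = a / 8 % 2 := hmod.of_dvd h2q
    refine ⟨⟨⟨by omega, by omega⟩, Or.inr (Or.inr ⟨k, rfl, by omega, hsq⟩)⟩, ?_⟩
    have h := (mul_modEq_mul_iff (by norm_num : (8 : ℤ) ≠ 0)).2 hmod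
    rwa [← ha8, ← hm8] at h

/-- No fundamental discriminant, positive: for `16 ∣ m` and `a ≢ 1 (mod 4)`, `a ≢ 8, 12 (mod 16)`,
`{D ∈ posFundDiscrs X : D ≡ a (mod m)}` is empty. [cite: TaniguchiThorne2013, Lemma 21] -/
theorem posFundDiscrs_filter_modEq_eq_empty {m : ℕ} (hm16 : 16 ∣ m) {a : ℤ} (ha4 : a % 4 ≠ 1)
    (ha12 : a % 16 ≠ 12) (ha8 : a % 16 ≠ 8) (X : ℕ) :
    (posFundDiscrs X).filter (fun D => D ≡ a [ZMOD m]) = ∅ := by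
  have h16 : (16 : ℤ) ∣ (m : ℤ) := by exact_mod_cast hm16
  refine Finset.filter_eq_empty_iff.2 fun D hD hmod => ?_
  have hD16 : D % 16 = a % 16 := hmod.of_dvd h16
  rw [mem_posFundDiscrs, fundDiscr_cond_iff] at hD
  rcases hD.2 with ⟨hD1, -, -⟩ | ⟨d, rfl, hd3, -⟩ | ⟨k, rfl, hk, -⟩
  · omega
  · omega
  · omega

end Literature.NumberTheory.QuadraticFields

end
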